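import Summits.NavierStokesRegularity.NavierStokesRegularity.Theorems.CoriolisHeadLocalEnergyDriftNormalForm
import Literature.Analysis.FunctionSpaces.BMOJohnNirenbergLp
import HarnessLib

/-!
# CoriolisHeadLocalEnergyDriftNormalFormBMO — crux `NoCoRotatingCore` (stmt-NavierStokesRegularity-22676), line
# `local_energy_rescue` (crux workfile, ns-idea-10 g3), stub S1 `stub_driftNormalForm`: S1 from a `BMO` Riesz pressure

`driftNormalForm_of_memBMO_rieszPressure`: the conclusion of S1 (skeleton's `E3` spelled out) follows for a bounded smooth
rotated profile `(ν, a, B, U, P)` as soon as there is a smooth `N` with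

  `ΔN = −tr (DU ∘ DU)`  and  `N ∈ BMO` (tree `Literature.Analysis.FunctionSpaces.MemBMO`, mean oscillation over balls).

This is the P-FREE form of the hypothesis of `driftNormalForm_of_rieszPressure` (file `…DriftNormalForm`): the pressure
Poisson equation `ΔP = −tr (DU ∘ DU)` of the rotated profile is in the tree (`laplacian_pressure_eq_of_rotated`), and the
quadratic oscillation bound `∫_{B(z,ρ)} (N − m)² ≤ K ρ³` follows from `N ∈ BMO` by the John–Nirenberg inequality in `L²`
form (tree `exists_lintegral_ball_enorm_sub_average_rpow_le`, `p = 2`; `exists_sq_oscillation_le_of_memBMO`).  What then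
remains of S1 is exactly ONE harmonic-analysis fact about `U` alone: the Riesz pressure `N = −RᵢRⱼ(UᵢUⱼ)` of a bounded
smooth divergence-free field is a smooth `BMO` solution of `ΔN = −∂ᵢ∂ⱼ(UᵢUⱼ) = −tr (DU ∘ DU)` (Calderón–Zygmund operators map
`L^∞` to `BMO`: Grafakos, *Modern Fourier Analysis* (2009), Cor. 3.4.10 and Remark 3.4.11; Stein 1993, IV §4.1; used for the
pressure of bounded (ancient/mild) solutions in Koch–Nadirashvili–Seregin–Šverák 2009 and Seregin 2014, Def. 6.3 / Prop. 3.9)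
— NOT in the tree and NOT proved here.

HONEST FRAMING.  Helper for an unregistered line; S1 itself, `NoCoRotatingCore` and NS regularity are NOT proved.

References: F. John, L. Nirenberg, CPAM 14 (1961) [JohnNirenberg1961]; E. M. Stein, *Harmonic Analysis* (1993), IV.1.3
[SteinHA1993]; G. Koch, N. Nadirashvili, G. Seregin, V. Šverák, Acta Math. 203 (2009) [KochNadirashviliSereginSverak2009].
-/

noncomputable section

open MeasureTheory Set Function Filter Topology Metric InnerProductSpace Real
open scoped RealInnerProductSpace Laplacian ContDiff Topology NNReal

-- the crux's namespace is already a prefix of the route's; silence the duplicate-namespace linter as the sibling files do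
set_option linter.dupNamespace false

namespace Summit.NavierStokesRegularity.NavierStokesRegularity.Theorems.CoriolisHead

namespace LocalEnergyRescue

open Literature.Analysis.FluidPDE Literature.Analysis.FunctionSpaces

/-- **`BMO` ⇒ quadratic oscillation `≤ K ρ³` on every ball of `ℝ³`.**  For a continuous `N ∈ BMO(ℝ³)` there is `K` with
`∫_{B(z,ρ)} (N − m)² ≤ K ρ³` for all `z`, `ρ > 0` (with `m` the ball average): the John–Nirenberg inequality in `L²` form
`∫_B |N − N_B|² ≤ C ‖N‖_*² |B|` (tree `exists_lintegral_ball_enorm_sub_average_rpow_le`, `p = 2`) and `|B(z,ρ)| = |B₁| ρ³`.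
[cite: SteinHA1993, IV.1.3, Corollary (b) of the Theorem] -/
theorem exists_sq_oscillation_le_of_memBMO {N : EuclideanSpace ℝ (Fin 3) → ℝ} (hNc : Continuous N) (hN : MemBMO N) :
    ∃ K : ℝ, ∀ (z : EuclideanSpace ℝ (Fin 3)) (ρ : ℝ), 0 < ρ →
      ∃ m : ℝ, ∫ y in ball z ρ, (N y - m) ^ 2 ≤ K * ρ ^ 3 := by
  obtain ⟨C, hC⟩ := exists_lintegral_ball_enorm_sub_average_rpow_le (E := EuclideanSpace ℝ (Fin 3)) (F := ℝ)
    (p := 2) two_pos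
  refine ⟨(C : ℝ) * (eBMOSeminorm N).toReal ^ 2 * (volume (ball (0 : EuclideanSpace ℝ (Fin 3)) 1)).toReal,
    fun z ρ hρ => ⟨⨍ w in ball z ρ, N w, ?_⟩⟩
  have h := hC N hN z ρ hρ
  have hfin : (C : ENNReal) * eBMOSeminorm N ^ (2 : ℝ) * volume (ball z ρ) ≠ ⊤ :=
    ENNReal.mul_ne_top (ENNReal.mul_ne_top ENNReal.coe_ne_top
      (ENNReal.rpow_ne_top_of_nonneg (by norm_num) hN.eBMOSeminorm_lt_top.ne)) measure_ball_lt_top.ne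
  -- the Bochner integral as a lower integral
  have hnn : 0 ≤ᵐ[volume.restrict (ball z ρ)] fun y => (N y - ⨍ w in ball z ρ, N w) ^ 2 :=
    Eventually.of_forall fun y => sq_nonneg _
  have hmeas : AEStronglyMeasurable (fun y => (N y - ⨍ w in ball z ρ, N w) ^ 2) (volume.restrict (ball z ρ)) :=
    ((hNc.sub continuous_const).pow 2).aestronglyMeasurable
  rw [integral_eq_lintegral_of_nonneg_ae hnn hmeas]
  have hpt : ∀ y, ENNReal.ofReal ((N y - ⨍ w in ball z ρ, N w) ^ 2) = ‖N y - ⨍ w in ball z ρ, N w‖ₑ ^ (2 : ℝ) := by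
    intro y
    rw [ENNReal.rpow_two, ← ofReal_norm, ← ENNReal.ofReal_pow (norm_nonneg _), Real.norm_eq_abs, sq_abs]
  simp_rw [hpt]
  have hle := ENNReal.toReal_mono hfin h
  refine hle.trans_eq ?_
  rw [ENNReal.toReal_mul, ENNReal.toReal_mul, ENNReal.coe_toReal, ← ENNReal.toReal_rpow, Real.rpow_two,
    Measure.addHaar_ball volume z hρ.le, finrank_euclideanSpace_fin, ENNReal.toReal_mul,
    ENNReal.toReal_ofReal (by positivity)]
  ring

end LocalEnergyRescue

open LocalEnergyRescue Literature.Analysis.FluidPDE Literature.Analysis.FunctionSpaces in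
/-- **S1 `stub_driftNormalForm` from a `BMO` Riesz pressure.**  If a bounded smooth rotated profile `(ν, a, B, U, P)` (ANY
`ν, a > 0`, skew `B`) admits a smooth `N` with `ΔN = −tr (DU ∘ DU)` and `N ∈ BMO(ℝ³)`, then the conclusion of S1 holds verbatim
(skeleton's `E3` spelled out): a recentring `U(· + y₀) − b` solves the same system with a pressure of bounded quadratic mean
oscillation.  Proof: `ΔP = −tr (DU ∘ DU) = ΔN` (tree `laplacian_pressure_eq_of_rotated`), John–Nirenberg
(`exists_sq_oscillation_le_of_memBMO`), and `driftNormalForm_of_rieszPressure`.  The remaining input — that the Riesz pressure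
`−RᵢRⱼ(UᵢUⱼ)` is such an `N` (Calderón–Zygmund `L^∞ → BMO`) — is NOT proved here; nor are S1, `NoCoRotatingCore`, NS regularity.
[cite: KochNadirashviliSereginSverak2009, §5; SteinHA1993, IV.1.3 and IV.4.1] -/
theorem driftNormalForm_of_memBMO_rieszPressure :
    ∀ (ν a : ℝ), 0 < ν → 0 < a → ∀ (B : EuclideanSpace ℝ (Fin 3) →L[ℝ] EuclideanSpace ℝ (Fin 3))
      (U : EuclideanSpace ℝ (Fin 3) → EuclideanSpace ℝ (Fin 3)) (P : EuclideanSpace ℝ (Fin 3) → ℝ),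
      ContDiff ℝ (⊤ : ℕ∞) U → ContDiff ℝ 2 P → (∀ x, inner ℝ (B x) x = 0) →
      Literature.Analysis.FluidPDE.VectorCalculus.IsDivFree U →
      (∀ y, -(ν • Laplacian.laplacian U y) + a • U y + a • fderiv ℝ U y y
        + (B (U y) - fderiv ℝ U y (B y)) + Literature.Analysis.FluidPDE.convect U U y
        + gradient P y = 0) →
      (∃ M : ℝ, ∀ y, ‖U y‖ ≤ M) →
      (∃ N : EuclideanSpace ℝ (Fin 3) → ℝ, ContDiff ℝ (⊤ : ℕ∞) N ∧
        (∀ y, Laplacian.laplacian N y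
          = -Literature.Analysis.FluidPDE.traceCLM ((fderiv ℝ U y).comp (fderiv ℝ U y))) ∧
        Literature.Analysis.FunctionSpaces.MemBMO N) →
      ∃ (y₀ b : EuclideanSpace ℝ (Fin 3)) (P' : EuclideanSpace ℝ (Fin 3) → ℝ) (K : ℝ),
        ContDiff ℝ (⊤ : ℕ∞) (fun y => U (y + y₀) - b) ∧ ContDiff ℝ 2 P' ∧
        Literature.Analysis.FluidPDE.VectorCalculus.IsDivFree (fun y => U (y + y₀) - b) ∧
        (∀ y, -(ν • Laplacian.laplacian (fun y => U (y + y₀) - b) y) + a • (fun y => U (y + y₀) - b) y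
          + a • fderiv ℝ (fun y => U (y + y₀) - b) y y
          + (B ((fun y => U (y + y₀) - b) y) - fderiv ℝ (fun y => U (y + y₀) - b) y (B y))
          + Literature.Analysis.FluidPDE.convect (fun y => U (y + y₀) - b) (fun y => U (y + y₀) - b) y
          + gradient P' y = 0) ∧
        (∃ M' : ℝ, ∀ y, ‖(fun y => U (y + y₀) - b) y‖ ≤ M') ∧
        (∀ (z : EuclideanSpace ℝ (Fin 3)) (ρ : ℝ), 0 < ρ →
          ∃ m : ℝ, ∫ y in Metric.ball z ρ, (P' y - m) ^ 2 ≤ K * ρ ^ 3) := by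
  intro ν a hν ha B U P hU hP hB hdiv heq hbdd hN
  obtain ⟨N, hNs, hΔN, hNbmo⟩ := hN
  obtain ⟨K, hK⟩ := exists_sq_oscillation_le_of_memBMO hNs.continuous hNbmo
  have hΔ : ∀ y, Laplacian.laplacian N y = Laplacian.laplacian P y := fun y => by
    rw [hΔN y, laplacian_pressure_eq_of_rotated (hU.of_le (by norm_cast)) hP hdiv heq y]
  exact driftNormalForm_of_rieszPressure ν a hν ha B U P hU hP hB hdiv heq hbdd ⟨N, K, hNs, hΔ, hK⟩

end Summit.NavierStokesRegularity.NavierStokesRegularity.Theorems.CoriolisHead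

end
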